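import Summits.PneNP.PneNP.Theorems.ConvexRankGatesCliqueExtLowerBoundWidthThresholdDefs
import Summits.PneNP.PneNP.Theorems.ConvexRankGatesCliqueExtLowerBoundConvHellyReduction
import Summits.PneNP.PneNP.Theorems.ConvexRankGatesCliqueExtLowerBoundRealInline

/-!
# CONV gates of bounded psd dimension are real programs (line `width-threshold-certificate-sparsity`, reshape r6)

`conv_boundedDim_classProgram`: a CONV gate of psd dimension `q ≤ Q` (ANY number of rows `p`,
`p + q ≤ m^c`) has the CLASS-PROGRAM PROPERTY at exponent `(c+1)(Q²+2)+1`: by the landed HELLY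
REDUCTION (`…ConvHellyReduction`: `sdpFeasible_iff_forall_card_le`) the gate accepts `v` iff every
sub-system of rows `I` with `#I ≤ q²+1` is feasible; so on class-constant inputs it is the threshold
`N ≤ ·` of the last wire of the real program laid out on the grid `(Fin p ⊕ Fin N) × Fin (n'+2)`:
row `i < p` holds the `n'+2` prefix sums of the merged weights `B' i κ = ∑_{cls j = κ} B i j`
(column `κ` = the sum over the classes `< κ`, binary gates `z₀ + B' i κ · z₁`), and for each of the
`N ≤ (q²+2)(p+1)^{q²+1}` row sets `I_l` (`#I_l ≤ q²+1`, enumerated by `equivFin`) row `p + l` holds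
in column `0` ONE monotone gate of arity `#I_l ≤ Q²+1` deciding the sub-system `I_l` on the full sums
of its rows (a `0/1` value) and in column `1` the partial sum of these values over `l' ≤ l` (binary
`+` gates); all gate values are `1` iff the last partial sum is `≥ N`. Length
`(p + N)(n'+2) ≤ m^{(c+1)(Q²+2)+1} (n'+1)` for `m ≥ 2` (using `⌊m^{1/16}⌋₊ ≥ max 2 (Q²+1)`),
fan-in `≤ max 2 (Q²+1) ≤ ⌊m^{1/16}⌋₊`.
-/

set_option linter.dupNamespace false

open Literature.Computability.Complexity Finset

namespace Summit.PneNP.PneNP.Theorems.CliqueExtLowerBound.WidthThreshold.ConvBoundedDim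

/-! ## §1 Arithmetic and counting -/

/-- The number of row sets `I ⊆ Fin p` with `#I ≤ d` is at most `(d+1)(p+1)^d`
(`∑_{t ≤ d} C(p,t)`, `C(p,t) ≤ p^t ≤ (p+1)^d`). [folklore] -/
theorem card_smallSets_le (p d : ℕ) :
    #((univ : Finset (Finset (Fin p))).filter (fun I => #I ≤ d)) ≤ (d + 1) * (p + 1) ^ d := by
  calc #((univ : Finset (Finset (Fin p))).filter (fun I => #I ≤ d))
      ≤ #((range (d + 1)).biUnion fun t => powersetCard t (univ : Finset (Fin p))) := by
        refine card_le_card fun I hI => ?_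
        rw [mem_filter] at hI
        exact mem_biUnion.2 ⟨#I, mem_range.2 (Nat.lt_succ_of_le hI.2),
          mem_powersetCard.2 ⟨subset_univ _, rfl⟩⟩
    _ ≤ ∑ t ∈ range (d + 1), #(powersetCard t (univ : Finset (Fin p))) := card_biUnion_le
    _ ≤ ∑ _t ∈ range (d + 1), (p + 1) ^ d := sum_le_sum fun t ht => ?_
    _ = (d + 1) * (p + 1) ^ d := by rw [sum_const, card_range, smul_eq_mul]
  rw [card_powersetCard, card_univ, Fintype.card_fin]
  calc p.choose t ≤ p ^ t := Nat.choose_le_pow p t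
    _ ≤ (p + 1) ^ t := Nat.pow_le_pow_left (Nat.le_succ p) t
    _ ≤ (p + 1) ^ d := Nat.pow_le_pow_right (Nat.succ_pos p) (Nat.lt_succ_iff.1 (mem_range.1 ht))

/-- Length bookkeeping: `(p + (q²+2)(p+1)^{q²+1})(n'+2) ≤ m^{(c+1)(Q²+2)+1}(n'+1)` when `q ≤ Q`,
`p ≤ m^c`, `m ≥ 2` and `max 2 (Q²+1) ≤ F`, `F^16 ≤ m` (the landed
`RealInline.floor_pow_sixteen_le`). [folklore] -/
theorem size_arith {T p q Q m c n' F : ℕ}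
    (hT : T ≤ (p + (q * q + 1 + 1) * (p + 1) ^ (q * q + 1)) * (n' + 2)) (hq : q ≤ Q)
    (hp : p ≤ m ^ c) (hm : 2 ≤ m) (hQF : Q * Q + 1 ≤ F) (h2F : 2 ≤ F) (hF : F ^ 16 ≤ m) :
    T ≤ m ^ ((c + 1) * (Q * Q + 2) + 1) * (n' + 1) := by
  set D := Q * Q + 1 with hD
  have hdD : q * q + 1 ≤ D := Nat.succ_le_succ (Nat.mul_le_mul hq hq)
  have hp1 : p + 1 ≤ m ^ (c + 1) :=
    calc p + 1 ≤ m ^ c + m ^ c := add_le_add hp (Nat.one_le_pow _ _ (by omega))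
      _ = m ^ c * 2 := by ring
      _ ≤ m ^ c * m := Nat.mul_le_mul_left _ hm
      _ = m ^ (c + 1) := by ring
  have hpow : (p + 1) ^ D ≤ m ^ ((c + 1) * D) := by
    rw [pow_mul]; exact Nat.pow_le_pow_left hp1 D
  have hN : (q * q + 1 + 1) * (p + 1) ^ (q * q + 1) ≤ (D + 1) * (p + 1) ^ D :=
    Nat.mul_le_mul (by omega) (Nat.pow_le_pow_right (by omega) hdD)
  have hpD : p ≤ (p + 1) ^ D :=
    calc p ≤ (p + 1) ^ 1 := by rw [pow_one]; omega
      _ ≤ (p + 1) ^ D := Nat.pow_le_pow_right (by omega) (by omega)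
  have h4 : 2 * (D + 2) ≤ m := by
    have h15 : 2 ^ 15 ≤ F ^ 15 := Nat.pow_le_pow_left h2F 15
    calc 2 * (D + 2) ≤ 4 * F := by omega
      _ ≤ F ^ 15 * F := Nat.mul_le_mul_right _ (le_trans (by norm_num) h15)
      _ = F ^ 16 := by ring
      _ ≤ m := hF
  calc T ≤ (p + (q * q + 1 + 1) * (p + 1) ^ (q * q + 1)) * (n' + 2) := hT
    _ ≤ (p + (D + 1) * (p + 1) ^ D) * (2 * (n' + 1)) :=
        Nat.mul_le_mul (Nat.add_le_add_left hN p) (by omega)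
    _ ≤ ((D + 2) * (p + 1) ^ D) * (2 * (n' + 1)) := by
        refine Nat.mul_le_mul_right _ ?_
        calc p + (D + 1) * (p + 1) ^ D ≤ (p + 1) ^ D + (D + 1) * (p + 1) ^ D :=
              Nat.add_le_add_right hpD _
          _ = (D + 2) * (p + 1) ^ D := by ring
    _ = (2 * (D + 2)) * (p + 1) ^ D * (n' + 1) := by ring
    _ ≤ m * m ^ ((c + 1) * D) * (n' + 1) :=
        Nat.mul_le_mul_right _ (Nat.mul_le_mul h4 hpow)
    _ = m ^ ((c + 1) * D + 1) * (n' + 1) := by ring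
    _ ≤ m ^ ((c + 1) * (Q * Q + 2) + 1) * (n' + 1) := by
        refine Nat.mul_le_mul_right _ (Nat.pow_le_pow_right (by omega) ?_)
        exact Nat.succ_le_succ (Nat.mul_le_mul_left _ (by omega))

/-- Row-major ordering of the grid: an entry of an earlier row is an earlier wire. [folklore] -/
theorem idx_lt {W a b x y : ℕ} (hab : a < b) (hx : x < W) : x + W * a < y + W * b := by
  have h : W * (a + 1) ≤ W * b := Nat.mul_le_mul_left W hab
  rw [Nat.mul_succ] at h
  omega

/-- `[P] = 1 ↔ P` for the real indicator `[P] ∈ {0,1}`. [folklore] -/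
theorem ite_eq_one_iff (P : Prop) [Decidable P] : (if P then (1 : ℝ) else 0) = 1 ↔ P := by
  by_cases h : P <;> simp [h]

/-- A sum of `N` reals `≤ 1` is `≥ N` iff all of them equal `1`. [folklore] -/
theorem card_le_sum_iff {N : ℕ} (f : Fin N → ℝ) (hf : ∀ l, f l ≤ 1) :
    (N : ℝ) ≤ ∑ l, f l ↔ ∀ l, f l = 1 := by
  constructor
  · intro h l
    by_contra hne
    have hlt : ∑ l, f l < ∑ _l : Fin N, (1 : ℝ) :=
      sum_lt_sum (fun l _ => hf l) ⟨l, mem_univ _, lt_of_le_of_ne (hf l) hne⟩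
    simp only [sum_const, card_univ, Fintype.card_fin, nsmul_eq_mul, mul_one] at hlt
    linarith
  · intro h
    simp [h]

/-! ## §2 Semidefinite sub-systems -/

open Classical in
/-- The indicator of feasibility of a semidefinite system is monotone in the right-hand sides.
[folklore] -/
theorem monotone_feasInd {q k : ℕ} (A' : Fin k → Matrix (Fin q) (Fin q) ℝ) (b' : Fin k → ℝ) :
    Monotone fun z : Fin k → ℝ => if ∃ Y : Matrix (Fin q) (Fin q) ℝ, Y.PosSemidef ∧
      ∀ a, (A' a * Y).trace ≤ b' a + z a then (1 : ℝ) else 0 := by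
  intro z z' hzz'
  dsimp only
  split_ifs with h h'
  · exact le_rfl
  · obtain ⟨Y, hY, hrows⟩ := h
    exact absurd ⟨Y, hY, fun a => (hrows a).trans (add_le_add le_rfl (hzz' a))⟩ h'
  · exact zero_le_one
  · exact le_rfl

/-- Re-indexing the sub-system of the rows `i ∈ I` by `Fin #I` (via `I.equivFin`). [folklore] -/
theorem feas_reindex {p q : ℕ} (A : Fin p → Matrix (Fin q) (Fin q) ℝ) (β : Fin p → ℝ)
    (I : Finset (Fin p)) :
    (∃ Y : Matrix (Fin q) (Fin q) ℝ, Y.PosSemidef ∧ ∀ i ∈ I, (A i * Y).trace ≤ β i) ↔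
      ∃ Y : Matrix (Fin q) (Fin q) ℝ, Y.PosSemidef ∧
        ∀ a : Fin #I, (A (I.equivFin.symm a) * Y).trace ≤ β (I.equivFin.symm a) := by
  constructor
  · rintro ⟨Y, hY, h⟩
    exact ⟨Y, hY, fun a => h _ (I.equivFin.symm a).2⟩
  · rintro ⟨Y, hY, h⟩
    refine ⟨Y, hY, fun i hi => ?_⟩
    simpa only [Equiv.symm_apply_apply] using h (I.equivFin ⟨i, hi⟩)

/-! ## §3 Wires of a real straight-line program -/

/-- A constant-`0` wire (arity `0`). [folklore] -/
theorem wire_const {n' T K : ℕ} (ev : (Fin n' → Bool) → Fin T → ℝ) {w : Fin T}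
    (heq : ∀ u : Fin n' → Bool, ev u w = 0) :
    ∃ (k : ℕ) (src : Fin k → Fin n' ⊕ Fin T) (ψ : (Fin k → ℝ) → ℝ), k ≤ K ∧
      (∀ i t', src i = Sum.inr t' → t' < w) ∧ Monotone ψ ∧ ∀ u : Fin n' → Bool,
        ev u w = ψ (fun i => Sum.elim (fun j => if u j then (1 : ℝ) else 0) (ev u) (src i)) :=
  ⟨0, Fin.elim0, fun _ => 0, Nat.zero_le K, fun i => Fin.elim0 i, fun _ _ _ => le_rfl, heq⟩

/-- A wire computed by a monotone gate of arity `k ≤ K` reading earlier wires. [folklore] -/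
theorem wire_gate {n' T K k : ℕ} (ev : (Fin n' → Bool) → Fin T → ℝ) {w : Fin T} (hk : k ≤ K)
    (src : Fin k → Fin T) (hsrc : ∀ a, src a < w) (ψ : (Fin k → ℝ) → ℝ) (hψ : Monotone ψ)
    (heq : ∀ u : Fin n' → Bool, ev u w = ψ (fun a => ev u (src a))) :
    ∃ (k : ℕ) (src : Fin k → Fin n' ⊕ Fin T) (ψ : (Fin k → ℝ) → ℝ), k ≤ K ∧
      (∀ i t', src i = Sum.inr t' → t' < w) ∧ Monotone ψ ∧ ∀ u : Fin n' → Bool,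
        ev u w = ψ (fun i => Sum.elim (fun j => if u j then (1 : ℝ) else 0) (ev u) (src i)) :=
  ⟨k, fun a => Sum.inr (src a), ψ, hk, fun a t' h => by cases h; exact hsrc a, hψ, heq⟩

/-- An affine binary wire `z₀ + a·z₁` (`a ≥ 0`) reading an earlier wire and a leaf. [folklore] -/
theorem wire_affine_leaf {n' T K : ℕ} (hK : 2 ≤ K) (ev : (Fin n' → Bool) → Fin T → ℝ) {w : Fin T}
    (t₀ : Fin T) (κ : Fin n') (a : ℝ) (ha : 0 ≤ a) (ht₀ : t₀ < w)
    (heq : ∀ u : Fin n' → Bool, ev u w = ev u t₀ + a * (if u κ then (1 : ℝ) else 0)) :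
    ∃ (k : ℕ) (src : Fin k → Fin n' ⊕ Fin T) (ψ : (Fin k → ℝ) → ℝ), k ≤ K ∧
      (∀ i t', src i = Sum.inr t' → t' < w) ∧ Monotone ψ ∧ ∀ u : Fin n' → Bool,
        ev u w = ψ (fun i => Sum.elim (fun j => if u j then (1 : ℝ) else 0) (ev u) (src i)) := by
  refine ⟨2, ![Sum.inr t₀, Sum.inl κ], fun z => z 0 + a * z 1, hK, ?_,
    fun z z' h => add_le_add (h 0) (mul_le_mul_of_nonneg_left (h 1) ha), fun u => by simpa using heq u⟩
  intro i t' hi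
  fin_cases i
  · simp only [Fin.zero_eta, Fin.isValue, Matrix.cons_val_zero, Sum.inr.injEq] at hi
    exact hi ▸ ht₀
  · simp at hi

/-- An affine binary wire `z₀ + a·z₁` (`a ≥ 0`) reading two earlier wires. [folklore] -/
theorem wire_affine_wire {n' T K : ℕ} (hK : 2 ≤ K) (ev : (Fin n' → Bool) → Fin T → ℝ) {w : Fin T}
    (t₀ t₁ : Fin T) (a : ℝ) (ha : 0 ≤ a) (ht₀ : t₀ < w) (ht₁ : t₁ < w)
    (heq : ∀ u : Fin n' → Bool, ev u w = ev u t₀ + a * ev u t₁) :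
    ∃ (k : ℕ) (src : Fin k → Fin n' ⊕ Fin T) (ψ : (Fin k → ℝ) → ℝ), k ≤ K ∧
      (∀ i t', src i = Sum.inr t' → t' < w) ∧ Monotone ψ ∧ ∀ u : Fin n' → Bool,
        ev u w = ψ (fun i => Sum.elim (fun j => if u j then (1 : ℝ) else 0) (ev u) (src i)) := by
  refine ⟨2, ![Sum.inr t₀, Sum.inr t₁], fun z => z 0 + a * z 1, hK, ?_,
    fun z z' h => add_le_add (h 0) (mul_le_mul_of_nonneg_left (h 1) ha), fun u => by simpa using heq u⟩
  intro i t' hi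
  fin_cases i
  · simp only [Fin.zero_eta, Fin.isValue, Matrix.cons_val_zero, Sum.inr.injEq] at hi
    exact hi ▸ ht₀
  · simp only [Fin.mk_one, Fin.isValue, Matrix.cons_val_one, Matrix.cons_val_fin_one,
      Sum.inr.injEq] at hi
    exact hi ▸ ht₁

/-! ## §4 The real program of a CONV gate of psd dimension `q` -/

/-- **Core construction.** For CONV data `(A, b, B')` on `n'` inputs with `p` rows and psd
dimension `q`, and any fan-in bound `K ≥ max 2 (q²+1)`, there is a monotone real straight-line
program of length `≤ (p + (q²+2)(p+1)^{q²+1})(n'+2)` and fan-in `≤ K` whose output wire `t`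
satisfies `feasible(u) ↔ θ ≤ ev u t`. [folklore] -/
theorem core {n' p q K : ℕ} (A : Fin p → Matrix (Fin q) (Fin q) ℝ) (b : Fin p → ℝ)
    (B' : Fin p → Fin n' → ℝ) (hB' : ∀ i κ, 0 ≤ B' i κ) (hK2 : 2 ≤ K) (hKq : q * q + 1 ≤ K) :
    ∃ (T : ℕ) (ev : (Fin n' → Bool) → Fin T → ℝ) (t : Fin T) (θ : ℝ),
      T ≤ (p + (q * q + 1 + 1) * (p + 1) ^ (q * q + 1)) * (n' + 2) ∧
      (∀ w : Fin T, ∃ (k : ℕ) (src : Fin k → Fin n' ⊕ Fin T) (ψ : (Fin k → ℝ) → ℝ), k ≤ K ∧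
        (∀ i t', src i = Sum.inr t' → t' < w) ∧ Monotone ψ ∧ ∀ u : Fin n' → Bool,
          ev u w = ψ (fun i => Sum.elim (fun j => if u j then (1 : ℝ) else 0) (ev u) (src i))) ∧
      ∀ u : Fin n' → Bool, (∃ Y : Matrix (Fin q) (Fin q) ℝ, Y.PosSemidef ∧
          ∀ i, (A i * Y).trace ≤ b i + ∑ κ, B' i κ * (if u κ then (1 : ℝ) else 0)) ↔ θ ≤ ev u t := by
  classical
  -- (1) the small row sets `I_l`, `l < N`
  obtain ⟨N, hN, hNle, I_, hI_card, hI_surj⟩ : ∃ N : ℕ, 0 < N ∧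
      N ≤ (q * q + 1 + 1) * (p + 1) ^ (q * q + 1) ∧ ∃ I_ : Fin N → Finset (Fin p),
        (∀ l, #(I_ l) ≤ q * q + 1) ∧ ∀ I : Finset (Fin p), #I ≤ q * q + 1 → ∃ l, I_ l = I := by
    set 𝓘 := (univ : Finset (Finset (Fin p))).filter (fun I => #I ≤ q * q + 1) with h𝓘
    refine ⟨#𝓘, card_pos.2 ⟨∅, mem_filter.2 ⟨mem_univ _, by simp⟩⟩, card_smallSets_le p _,
      fun l => (𝓘.equivFin.symm l).1, fun l => (mem_filter.1 (𝓘.equivFin.symm l).2).2,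
      fun I hI => ⟨𝓘.equivFin ⟨I, mem_filter.2 ⟨mem_univ _, hI⟩⟩, by simp⟩⟩
  -- (2) prefix sums of the merged weights (row `i`, column `κ` = classes `< κ`)
  obtain ⟨col, hcol0, hcolS, hcolS', hcolN⟩ : ∃ col : (Fin n' → Bool) → Fin p → ℕ → ℝ,
      (∀ u i, col u i 0 = 0) ∧
      (∀ u i (κ : ℕ) (h : κ < n'),
        col u i (κ + 1) = col u i κ + B' i ⟨κ, h⟩ * (if u ⟨κ, h⟩ then (1 : ℝ) else 0)) ∧
      (∀ u i κ, n' ≤ κ → col u i (κ + 1) = col u i κ) ∧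
      ∀ u i, col u i (n' + 1) = ∑ κ, B' i κ * (if u κ then (1 : ℝ) else 0) := by
    refine ⟨fun u i κ => ∑ x ∈ range κ,
        if h : x < n' then B' i ⟨x, h⟩ * (if u ⟨x, h⟩ then (1 : ℝ) else 0) else 0,
      fun u i => by simp, fun u i κ h => by simp [sum_range_succ, h],
      fun u i κ h => by simp [sum_range_succ, not_lt.2 h], fun u i => ?_⟩
    simp only
    rw [sum_range_succ, dif_neg (lt_irrefl _), add_zero, Finset.sum_fin_eq_sum_range]
  -- (3) the sub-system gates `G u l ∈ {0,1}` on the full sums of the rows of `I_l`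
  obtain ⟨G, hG⟩ : ∃ G : (Fin n' → Bool) → Fin N → ℝ, ∀ u l, G u l =
      if ∃ Y : Matrix (Fin q) (Fin q) ℝ, Y.PosSemidef ∧ ∀ a : Fin #(I_ l),
        (A ((I_ l).equivFin.symm a) * Y).trace ≤
          b ((I_ l).equivFin.symm a) + col u ((I_ l).equivFin.symm a) (n' + 1) then 1 else 0 :=
    ⟨_, fun u l => rfl⟩
  have hG1 : ∀ u l, G u l ≤ 1 := fun u l => by rw [hG]; split_ifs <;> norm_num
  -- (4) partial sums of the gate values
  obtain ⟨P, hP0, hPS, hPN⟩ : ∃ P : (Fin n' → Bool) → Fin N → ℝ,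
      (∀ u (l : Fin N), (l : ℕ) = 0 → P u l = G u l) ∧
      (∀ u (l l₀ : Fin N), (l : ℕ) = l₀ + 1 → P u l = P u l₀ + G u l) ∧
      ∀ u, P u ⟨N - 1, by omega⟩ = ∑ l, G u l := by
    refine ⟨fun u l => ∑ x ∈ range ((l : ℕ) + 1), if h : x < N then G u ⟨x, h⟩ else 0,
      fun u l hl => ?_, fun u l l₀ hl => ?_, fun u => ?_⟩
    · simp only
      rw [hl, zero_add, sum_range_one, dif_pos hN]
      congr 1; exact Fin.ext hl.symm
    · simp only
      rw [hl, sum_range_succ _ ((l₀ : ℕ) + 1), dif_pos (show (l₀ : ℕ) + 1 < N by omega)]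
      congr 2; exact Fin.ext hl.symm
    · show ∑ x ∈ range (N - 1 + 1), _ = _
      rw [Nat.sub_add_cancel hN, Finset.sum_fin_eq_sum_range]
  -- (5) the grid `(Fin p ⊕ Fin N) × Fin (n'+2)` in row-major order, and the wire values
  obtain ⟨e, he_inl, he_inr⟩ : ∃ e : (Fin p ⊕ Fin N) × Fin (n' + 2) ≃ Fin ((p + N) * (n' + 2)),
      (∀ i κ, (e (Sum.inl i, κ) : ℕ) = κ + (n' + 2) * i) ∧
      ∀ l κ, (e (Sum.inr l, κ) : ℕ) = κ + (n' + 2) * (p + l) :=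
    ⟨(Equiv.prodCongr finSumFinEquiv (Equiv.refl _)).trans finProdFinEquiv,
      fun i κ => by simp, fun l κ => by simp⟩
  obtain ⟨ev, hev_inl, hev_inr0, hev_inr1, hev_inr2⟩ :
      ∃ ev : (Fin n' → Bool) → Fin ((p + N) * (n' + 2)) → ℝ,
        (∀ u i κ, ev u (e (Sum.inl i, κ)) = col u i κ) ∧
        (∀ u l (κ : Fin (n' + 2)), (κ : ℕ) = 0 → ev u (e (Sum.inr l, κ)) = G u l) ∧
        (∀ u l (κ : Fin (n' + 2)), (κ : ℕ) = 1 → ev u (e (Sum.inr l, κ)) = P u l) ∧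
        ∀ u l (κ : Fin (n' + 2)), 2 ≤ (κ : ℕ) → ev u (e (Sum.inr l, κ)) = 0 := by
    refine ⟨fun u w => Sum.elim (fun i => col u i ((e.symm w).2 : ℕ))
      (fun l => if ((e.symm w).2 : ℕ) = 0 then G u l else if ((e.symm w).2 : ℕ) = 1 then P u l
        else 0) (e.symm w).1, fun u i κ => by simp, fun u l κ h => by simp [h],
      fun u l κ h => by simp [h], fun u l κ h => ?_⟩
    have h0 : (κ : ℕ) ≠ 0 := by omega
    have h1 : (κ : ℕ) ≠ 1 := by omega
    simp [h0, h1]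
  have hNm1 : N - 1 < N := by omega
  have h1lt : 1 < n' + 2 := by omega
  refine ⟨(p + N) * (n' + 2), ev, e (Sum.inr ⟨N - 1, hNm1⟩, ⟨1, h1lt⟩), N,
    Nat.mul_le_mul_right _ (Nat.add_le_add_left hNle p), ?_, ?_⟩
  · -- LOCALITY: every wire is a monotone gate of arity `≤ K` of leaves and earlier wires
    intro w
    obtain ⟨⟨ρ, κ⟩, rfl⟩ := e.surjective w
    rcases ρ with i | l
    · -- prefix-sum rows `i < p`
      rcases Nat.eq_zero_or_pos (κ : ℕ) with h0 | hpos
      · exact wire_const ev fun u => by rw [hev_inl, h0, hcol0]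
      · obtain ⟨κ₀, hκ₀⟩ : ∃ κ₀ : ℕ, (κ : ℕ) = κ₀ + 1 := ⟨κ - 1, by omega⟩
        have hκ₀lt : κ₀ < n' + 2 := by omega
        have hlt : e (Sum.inl i, ⟨κ₀, hκ₀lt⟩) < e (Sum.inl i, κ) := by
          rw [Fin.lt_def, he_inl, he_inl]; show κ₀ + _ < _; omega
        by_cases hκn : κ₀ < n'
        · exact wire_affine_leaf hK2 ev _ ⟨κ₀, hκn⟩ (B' i ⟨κ₀, hκn⟩) (hB' _ _) hlt fun u => by
            rw [hev_inl, hev_inl, hκ₀, hcolS u i κ₀ hκn]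
        · exact wire_affine_wire hK2 ev _ _ 0 le_rfl hlt hlt fun u => by
            rw [hev_inl, hev_inl, hκ₀, hcolS' u i κ₀ (not_lt.1 hκn)]; simp
    · -- gate rows `p + l`
      rcases Nat.lt_trichotomy (κ : ℕ) 1 with h0 | h1 | h2
      · -- column 0: the sub-system gate of `I_l`
        have h0' : (κ : ℕ) = 0 := by omega
        refine wire_gate ev ((hI_card l).trans hKq)
          (fun a => e (Sum.inl ((I_ l).equivFin.symm a), ⟨n' + 1, by omega⟩)) (fun a => ?_)
          (fun z => if ∃ Y : Matrix (Fin q) (Fin q) ℝ, Y.PosSemidef ∧ ∀ a : Fin #(I_ l),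
            (A ((I_ l).equivFin.symm a) * Y).trace ≤ b ((I_ l).equivFin.symm a) + z a
            then 1 else 0) (monotone_feasInd _ _) fun u => ?_
        · rw [Fin.lt_def, he_inl, he_inr]
          exact idx_lt (by have := ((I_ l).equivFin.symm a : Fin p).2; omega)
            (show n' + 1 < n' + 2 by omega)
        · rw [hev_inr0 u l κ h0', hG]; simp only [hev_inl]
      · -- column 1: the partial sums of the gate values
        have hlt0 : e (Sum.inr l, ⟨0, by omega⟩) < e (Sum.inr l, κ) := by
          rw [Fin.lt_def, he_inr, he_inr]; show 0 + _ < _; omega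
        rcases Nat.eq_zero_or_pos (l : ℕ) with hl | hl
        · exact wire_affine_wire hK2 ev _ _ 0 le_rfl hlt0 hlt0 fun u => by
            rw [hev_inr1 u l κ h1, hev_inr0 u l _ rfl, hP0 u l hl]; simp
        · obtain ⟨l₀, hl₀⟩ : ∃ l₀ : ℕ, (l : ℕ) = l₀ + 1 := ⟨l - 1, by omega⟩
          have hl₀N : l₀ < N := by omega
          refine wire_affine_wire hK2 ev (e (Sum.inr ⟨l₀, hl₀N⟩, ⟨1, h1lt⟩)) _ 1 zero_le_one
            ?_ hlt0 fun u => ?_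
          · rw [Fin.lt_def, he_inr, he_inr]
            exact idx_lt (show p + l₀ < p + (l : ℕ) by omega) h1lt
          · rw [hev_inr1 u l κ h1, hev_inr1 u _ _ rfl, hev_inr0 u l _ rfl, hPS u l ⟨l₀, hl₀N⟩ hl₀,
              one_mul]
      · exact wire_const ev fun u => hev_inr2 u l κ (by omega)
  · -- CORRECTNESS: feasible iff all `N` sub-system gates output `1` iff their sum is `≥ N`
    intro u
    rw [hev_inr1 u _ _ rfl, hPN u, card_le_sum_iff _ (hG1 u),
      ConvHelly.sdpFeasible_iff_forall_card_le A
        (fun i => b i + ∑ κ, B' i κ * (if u κ then (1 : ℝ) else 0))]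
    have key : ∀ l, G u l = 1 ↔ ∃ Y : Matrix (Fin q) (Fin q) ℝ, Y.PosSemidef ∧
        ∀ i ∈ I_ l, (A i * Y).trace ≤ b i + ∑ κ, B' i κ * (if u κ then (1 : ℝ) else 0) := by
      intro l
      rw [hG, ite_eq_one_iff,
        feas_reindex A (fun i => b i + ∑ κ, B' i κ * (if u κ then (1 : ℝ) else 0)) (I_ l)]
      simp only [hcolN]
    simp only [key]
    exact ⟨fun h l => h _ (hI_card l), fun h I hI => by
      obtain ⟨l, rfl⟩ := hI_surj I hI
      exact h l⟩

/-! ## §5 The registered statement -/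

open Classical in
/-- **Registered stub `conv_boundedDim_classProgram`** (crux stmt-PneNP-10682, line `width-threshold-certificate-sparsity`,
reshape r6). [cite: Jukna2012, Thm. 9.21] -/
theorem conv_boundedDim_classProgram : ∀ (Q m c : ℕ) (φ : GateFn), max 2 (Q * Q + 1) ≤ ⌊(m : ℝ) ^ (1 / 16 : ℝ)⌋₊ → 2 ≤ m → (∃ p q : ℕ, p +
    q ≤ m ^ c ∧ q ≤ Q ∧ ∃ (A : Fin p → Matrix (Fin q) (Fin q) ℝ) (b : Fin p → ℝ) (B : Fin p → Fin
    φ.1 → ℝ), (∀ i j, 0 ≤ B i j) ∧ ∀ v : Fin φ.1 → Bool, φ.2 v = true ↔ ∃ Y : Matrix (Fin q) (Fin q)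
    ℝ, Y.PosSemidef ∧ ∀ i, (A i * Y).trace ≤ b i + ∑ j, B i j * (if v j then (1 : ℝ) else 0)) → (∀
    (n' : ℕ) (cls : Fin φ.1 → Fin n'), ∃ (T K : ℕ) (ev : (Fin n' → Bool) → Fin T → ℝ) (t : Fin T) (θ
    : ℝ), T ≤ m ^ ((c + 1) * (Q * Q + 2) + 1) * (n' + 1) ∧ K ≤ ⌊(m : ℝ) ^ (1 / 16 : ℝ)⌋₊ ∧ (∀ w :
    Fin T, ∃ (k : ℕ) (src : Fin k → Fin n' ⊕ Fin T) (ψ : (Fin k → ℝ) → ℝ), k ≤ K ∧ (∀ i t', src i =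
    Sum.inr t' → t' < w) ∧ Monotone ψ ∧ ∀ u : Fin n' → Bool, ev u w = ψ (fun i => Sum.elim (fun j =>
    if u j then (1 : ℝ) else 0) (ev u) (src i))) ∧ ∀ u : Fin n' → Bool, φ.2 (fun j => u (cls j)) =
    true ↔ θ ≤ ev u t) := by
  rintro Q m c φ hK hm ⟨p, q, hpq, hqQ, A, b, B, hB, hφ⟩ n' cls
  -- merged weights `B' i κ = ∑_{cls j = κ} B i j`
  obtain ⟨B', hB'nn, hmerge⟩ : ∃ B' : Fin p → Fin n' → ℝ, (∀ i κ, 0 ≤ B' i κ) ∧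
      ∀ (u : Fin n' → Bool) (i : Fin p), ∑ j, B i j * (if u (cls j) then (1 : ℝ) else 0) =
        ∑ κ, B' i κ * (if u κ then (1 : ℝ) else 0) := by
    refine ⟨fun i κ => ∑ j ∈ univ.filter (fun j => cls j = κ), B i j,
      fun i κ => sum_nonneg fun j _ => hB i j, fun u i => ?_⟩
    rw [← sum_fiberwise univ cls fun j => B i j * (if u (cls j) then (1 : ℝ) else 0)]
    refine sum_congr rfl fun κ _ => ?_
    rw [sum_mul]
    exact sum_congr rfl fun j hj => by rw [(mem_filter.1 hj).2]
  obtain ⟨T, ev, t, θ, hT, hwires, hcorr⟩ := core (K := max 2 (Q * Q + 1)) A b B' hB'nn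
    (le_max_left _ _) (le_max_of_le_right (Nat.succ_le_succ (Nat.mul_le_mul hqQ hqQ)))
  refine ⟨T, max 2 (Q * Q + 1), ev, t, θ, size_arith hT hqQ (by omega) hm (le_of_max_le_right hK)
    (le_of_max_le_left hK) (RealInline.floor_pow_sixteen_le m), hK, hwires, fun u => ?_⟩
  rw [hφ]
  simp only [hmerge]
  exact hcorr u

end Summit.PneNP.PneNP.Theorems.CliqueExtLowerBound.WidthThreshold.ConvBoundedDim
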